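import Summits.QuantumFields.YangMills.Theses.FradkinShenkerFlow
import Literature.MathematicalPhysics.QuantumFieldTheory.BalabanSoftAveraging

/-!
# Rider `stub_straightPath_unique` (N3) of the line `rg-variance-cascade` (crux `SusceptibilityToPoincare`)

Route `FradkinShenkerFlow` of `YangMills`, crux item `stmt-QuantumFields-9441`
(`Summit.QuantumFields.YangMills.Theses.FradkinShenkerFlow.SusceptibilityToPoincare`, FS ⇒ UP),
registered skeleton `Cruxes/SusceptibilityToPoincare/Lines/rg_variance_cascade.lean`, rider N3 of
the necessity package "UP ⇒ TerminalPoincare": **a fine link lies on the straight block path of at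
most one coarse edge** (pure lattice geometry).

At block size `B` on the torus of side `N`, the straight-transporter block field
(`BalabanAveraging.link_rep_zero`) reads the fine field at the coarse edge `e = (y, μ)` only along
the STRAIGHT path `pathEdges (corner N B y) (List.replicate (width N B y μ) μ)` of `width N B y μ`
steps in direction `μ` from the corner `corner N B y = (B y₁, …, B y_d)`. We prove that these paths
are pairwise edge-disjoint: if a fine link `ℓ` lies on the straight paths of `e` and of `e'`, then
`e = e'` (so resampling one fine link moves at most one block link).

## Proof

* MEMBERSHIP (`StraightPath.snd_eq_and_exists_of_mem_pathEdges_replicate`, induction on the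
  number of steps): `ℓ ∈ pathEdges c (List.replicate w μ)` forces `ℓ.2 = μ` and
  `ℓ.1 = c + t e_μ` for some `t < w`.
* COORDINATES. Hence `e.2 = ℓ.2 = e'.2 =: μ`, and `corner y + t e_μ = corner y' + t' e_μ` with
  `t < width N B y μ = min B (N - y_μ B)` and likewise primed. Off the direction `μ` the corner
  coordinates `y_i B < N` and `y'_i B < N` agree in `ZMod N`, hence as naturals
  (`BalabanAveraging.val_corner`), so `y_i = y'_i` (`B > 0`). In the direction `μ` the naturals
  `y_μ B + t < N` and `y'_μ B + t' < N` agree in `ZMod N`, hence as naturals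
  (`ZMod.val_natCast_of_lt`), and dividing by `B` (`t, t' < B`) gives `y_μ = y'_μ`.
-/

noncomputable section

open MeasureTheory ProbabilityTheory
open Literature.MathematicalPhysics.QuantumFieldTheory

namespace Summit.QuantumFields.YangMills.Theorems.SusceptibilityToPoincare.RgVarianceCascade

namespace StraightPath

open Literature.MathematicalPhysics.QuantumLattice

/-- **Edges of a straight path**: an edge of the path of `w` steps in direction `μ` from `c` points
in direction `μ` and is based at `c + t e_μ` for some `t < w`. [folklore] -/
theorem snd_eq_and_exists_of_mem_pathEdges_replicate {d N : ℕ} {c : Site d N} {w : ℕ} {μ : Fin d}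
    {ℓ : Edge d N} (h : ℓ ∈ pathEdges c (List.replicate w μ)) :
    ℓ.2 = μ ∧ ∃ t < w, ℓ.1 = c + Pi.single μ ((t : ℕ) : ZMod N) := by
  induction w generalizing c with
  | zero =>
    rw [List.replicate_zero, BalabanAveraging.pathEdges_nil'] at h
    exact absurd h List.not_mem_nil
  | succ w ih =>
    rw [List.replicate_succ, BalabanAveraging.pathEdges_cons', List.mem_cons] at h
    rcases h with rfl | h
    · exact ⟨rfl, 0, Nat.zero_lt_succ _, by rw [Nat.cast_zero, Pi.single_zero, add_zero]⟩
    · obtain ⟨h2, t, ht, h1⟩ := ih h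
      refine ⟨h2, t + 1, Nat.succ_lt_succ ht, ?_⟩
      rw [h1, Site.shift, add_assoc, ← Pi.single_add, Nat.cast_succ, add_comm (1 : ZMod N)]

/-- The `μ`-th coordinate of `corner N B y + t e_μ` has representative `y_μ B + t` as long as
`y_μ B + t < N`. [folklore] -/
theorem val_corner_add_single {d N B : ℕ} (y : Site d (BalabanAveraging.blockSide N B)) (μ : Fin d)
    {t : ℕ} (h : (y μ).val * B + t < N) :
    ((BalabanAveraging.corner N B y + Pi.single μ ((t : ℕ) : ZMod N) : Site d N) μ).val =
      (y μ).val * B + t := by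
  rw [Pi.add_apply, Pi.single_eq_same]
  show ((((y μ).val * B : ℕ) : ZMod N) + ((t : ℕ) : ZMod N)).val = _
  rw [← Nat.cast_add, ZMod.val_natCast_of_lt h]

/-- Division with remainder: `(k B + t) / B = k` for `t < B`. [folklore] -/
theorem mul_add_div_of_lt {B k t : ℕ} (hB : 0 < B) (ht : t < B) : (k * B + t) / B = k := by
  rw [Nat.add_comm, Nat.add_mul_div_right _ _ hB, Nat.div_eq_of_lt ht, Nat.zero_add]

end StraightPath

/-- Rider N3 `stub_straightPath_unique`: **a fine link lies on the straight block path of at most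
one coarse edge.** If `ℓ ∈ pathEdges (corner N B e.1) (List.replicate (width N B e.1 e.2) e.2)` and
likewise for `e'`, then `e = e'`: both paths point in direction `ℓ.2`, so `e.2 = e'.2 =: μ`; the
base point of `ℓ` is `corner e.1 + t e_μ = corner e'.1 + t' e_μ` with `t < width ≤ min B (N - y_μ B)`;
off `μ` the corner coordinates `y_i B, y'_i B < N` agree mod `N` hence in `ℕ`, and along `μ` the
naturals `y_μ B + t, y'_μ B + t' < N` agree mod `N` hence in `ℕ`, whence `y_μ = y'_μ` on dividing
by `B` (`t, t' < B`). [folklore] -/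
theorem stub_straightPath_unique :
    ∀ (d N B : ℕ) [NeZero N] [NeZero B] (e e' : Edge d (BalabanAveraging.blockSide N B)) (ℓ : Edge d N),
      ℓ ∈ Literature.MathematicalPhysics.QuantumLattice.pathEdges (BalabanAveraging.corner N B e.1)
        (List.replicate (BalabanAveraging.width N B e.1 e.2) e.2) →
      ℓ ∈ Literature.MathematicalPhysics.QuantumLattice.pathEdges (BalabanAveraging.corner N B e'.1)
        (List.replicate (BalabanAveraging.width N B e'.1 e'.2) e'.2) →
      e = e' := by
  rintro d N B _ _ ⟨y, μ⟩ ⟨y', μ'⟩ ℓ he he'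
  obtain ⟨hμ, t, ht, hx⟩ := StraightPath.snd_eq_and_exists_of_mem_pathEdges_replicate he
  obtain ⟨hμ', t', ht', hx'⟩ := StraightPath.snd_eq_and_exists_of_mem_pathEdges_replicate he'
  dsimp only at hμ hμ' ht ht' hx hx'
  subst hμ hμ'
  have hB : 0 < B := NeZero.pos B
  refine Prod.ext (funext fun i => ZMod.val_injective _ ?_) rfl
  -- the base points agree coordinatewise
  have key := congrFun (hx.symm.trans hx') i
  by_cases hi : i = ℓ.2
  · -- along the direction of the path: `y_μ B + t = y'_μ B + t'` with `t, t' < B`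
    subst hi
    unfold BalabanAveraging.width at ht ht'
    obtain ⟨htB, htN⟩ := lt_min_iff.mp ht
    obtain ⟨htB', htN'⟩ := lt_min_iff.mp ht'
    have hlt : (y ℓ.2).val * B + t < N := by omega
    have hlt' : (y' ℓ.2).val * B + t' < N := by omega
    have hnat : (y ℓ.2).val * B + t = (y' ℓ.2).val * B + t' := by
      have hv := congrArg ZMod.val key
      rwa [StraightPath.val_corner_add_single y ℓ.2 hlt,
        StraightPath.val_corner_add_single y' ℓ.2 hlt'] at hv
    rw [← StraightPath.mul_add_div_of_lt (k := (y ℓ.2).val) hB htB, hnat,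
      StraightPath.mul_add_div_of_lt hB htB']
  · -- off the direction of the path: the corner coordinates `y_i B, y'_i B < N` agree
    rw [Pi.add_apply, Pi.add_apply, Pi.single_eq_of_ne hi, Pi.single_eq_of_ne hi, add_zero,
      add_zero] at key
    have hv := congrArg ZMod.val key
    rw [BalabanAveraging.val_corner, BalabanAveraging.val_corner] at hv
    exact Nat.eq_of_mul_eq_mul_right hB hv

end Summit.QuantumFields.YangMills.Theorems.SusceptibilityToPoincare.RgVarianceCascade

end
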